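import Summits.AtomisticToContinuum.FouriersLaw.Theorems.BondHeatUncertaintyBoundedResponseParityFloor
import Summits.AtomisticToContinuum.FouriersLaw.Theorems.BondHeatUncertaintyExtensiveSnapshotIrreversibilityEnergyWindowTriangularLower
import Literature.Probability.Divergences.FDivVariational
import HarnessLib

/-!
# `SnapshotKLLowerExpansion` — PROOF of the fixed-`N` piece (L₂) of node `ParityFloor`

Decomposition cell `decomp-a2c`, lens «grading / quantitative ladder», generation 95, beneath
`Summits/AtomisticToContinuum/FouriersLaw/Theorems/BondHeatUncertaintyBoundedResponseParityFloor.lean` (generation 94,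
in tree), which states

  (L₂) `SnapshotKLLowerExpansion` : fixed `N`; if `KL(μ_δ ‖ Θ_*μ_δ) ≤ Bδ²` eventually as `δ → 0`
       (`μ_δ = μ_{N,T+δ/2,T−δ/2}` the steady states, `Θ(q,p) = (q,−p)`, `B ≥ 0`), then `½·oddDefect(μ_{N,T,T}) h ≤ B`
       for every response density `h` at `(N,T)`,

and proves the seam `11071 ⟸ (D) ∧ (L) ∧ (L₂) ∧ (K)` (`boundedResponse_of_deficitCesaroPoint_snapshot`).  THIS FILE PROVES
(L₂) OUTRIGHT (`snapshotKLLowerExpansion_holds`), so that seam loses the hypothesis (L₂)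
(`boundedResponse_of_deficitCesaroPoint_parityFloor : (D) → (L) → (K) → BoundedResponse`, §3); with the sibling file
`…BondHeatUncertaintyBoundedResponseParityFloorProof.lean` ((L) proved, same generation) the door of record is
`11071 ⟸ (D) ∧ (K)` — the residual `DeficitCesaroPoint` and the route's crux `ExtensiveSnapshotIrreversibility` (stmt-9121).

## The proof (fixed `N`; no `N ≥ 2` needed; `μ_T = μ_{N,T,T}` = the pinned Gibbs measure by `UniqueNESS`)

The easy half of the Donsker–Varadhan principle (`Literature.Probability.Divergences.integral_le_toReal_klDiv_add_integral`,
in tree): `∫ g dμ_δ ≤ KL(μ_δ‖Θ_*μ_δ) + ∫ (e^{g} − 1) dΘ_*μ_δ` for bounded `g`.  At `g = δ(G − μ_T(G))`, `G ∈ C_c^∞`, after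
division by `δ²`: the response pairings at the test functions `G`, `G∘Θ`, `(G∘Θ)²`, the Taylor bound
`|e^u − 1 − u − u²/2| ≤ |u|³` (`|u| ≤ 1`, §1) and `Θ`-invariance of `μ_T` give in the limit `δ → 0`
`∫ G(h − h∘Θ) dμ_T − ½ Var_{μ_T}(G) ≤ B` (`dvCoef_le`, §2); optimising `G → h − h∘Θ` in `L²(μ_T)` (density of `C_c^∞`,
tree `exists_smooth_integral_sub_sq_le`) and the polarisation `∫ Gk − ½∫G² = ½∫k² − ½∫(G − k)²` yield
`½∫ (h − h∘Θ)² dμ_T ≤ B` (`snapshotKLLowerExpansion_holds`, §2).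

No `sorry`, no new axioms; imports only tree modules; restates nothing (frame and pieces are the tree's, namespace
`…Theorems.BoundedResponse.ParityFloor`).  References: [cite: PolyanskiyWu2024, Thm. 7.26] (Donsker–Varadhan);
[cite: MaesNetocny2010, Thm 3.1]; [cite: KunduDharNarayan2009, eqs. (reln2)–(reln3)].
-/

noncomputable section

open MeasureTheory Filter Topology InformationTheory
open scoped ENNReal NNReal ContDiff
open Literature.MathematicalPhysics.KineticTheory.HeatConduction
open Summit.AtomisticToContinuum.FouriersLaw.Theorems.ExtensiveSnapshotIrreversibility.Negative
open Summit.AtomisticToContinuum.FouriersLaw.Theorems.ExtensiveSnapshotIrreversibility.EnergyWindow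
  (exists_smooth_integral_sub_sq_le tendsto_of_tendsto_sub_div)

namespace Summit.AtomisticToContinuum.FouriersLaw.Theorems.BoundedResponse.ParityFloor

open Summit.AtomisticToContinuum.FouriersLaw.Theses.BondHeatUncertainty (BoundedResponse ExtensiveSnapshotIrreversibility)
open Summit.AtomisticToContinuum.FouriersLaw.Theorems.SubdiffusiveBondHeat.EscapeGrading (OhmicFloor)
open Summit.AtomisticToContinuum.FouriersLaw.Theorems.BoundedResponse.TransientBand (DeficitCesaroPoint TransientFloor)

variable {N : ℕ}

/-! ## §1–§2 The Taylor bound; the Donsker–Varadhan coefficient; (L₂) -/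

section KL

/-- Third-order Taylor bound for the exponential on `[-1,1]`: `|e^u − 1 − u − u²/2| ≤ |u|³` (`Real.exp_bound`). [folklore] -/
private theorem abs_exp_sub_taylor_two_le {u : ℝ} (hu : |u| ≤ 1) :
    |Real.exp u - 1 - u - u ^ 2 / 2| ≤ |u| ^ 3 := by
  have h := Real.exp_bound hu (show 0 < 3 by norm_num)
  have e : (∑ i ∈ Finset.range 3, u ^ i / (i.factorial : ℝ)) = 1 + u + u ^ 2 / 2 := by
    simp only [Finset.sum_range_succ, Finset.sum_range_zero, Nat.factorial]
    norm_num
  rw [e, show Real.exp u - (1 + u + u ^ 2 / 2) = Real.exp u - 1 - u - u ^ 2 / 2 by ring] at h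
  refine h.trans (mul_le_of_le_one_right (by positivity) ?_)
  norm_num [Nat.factorial]

variable {ω₂ lam β γ T : ℝ}

/-- **The Donsker–Varadhan coefficient of a test function is bounded by the snapshot-divergence rate.**
Fixed `N`, `μ_δ := μ_{N,T+δ/2,T−δ/2}` a steady-state family, `μ_T` the pinned Gibbs measure, `h ∈ L²(μ_T)` with the
response pairings `(μ_δ(F) − μ_T(F))/δ → ∫ F h dμ_T` (`F ∈ C_c^∞`),
`KL(μ_δ ‖ Θ_*μ_δ) ≤ Bδ²` eventually.  Then for every test function `G ∈ C_c^∞`: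
`∫ G·(h − h∘Θ) dμ_T − ½∫ G² dμ_T ≤ B`.
Proof: the variational bound `∫ g dμ_δ ≤ KL(μ_δ‖Θ_*μ_δ) + ∫ (e^{g} − 1) dΘ_*μ_δ`
(`Literature.Probability.Divergences.integral_le_toReal_klDiv_add_integral`) at `g = δ(G − μ_T(G))`, the response pairings
at `G`, `G∘Θ`, `(G∘Θ)²`, the Taylor bound `|e^u − 1 − u − u²/2| ≤ |u|³`, and flip-invariance of `μ_T`; the limit `δ → 0`
gives `∫ G(h − h∘Θ) − ½ Var_{μ_T}(G) ≤ B`. [cite: PolyanskiyWu2024, Thm. 7.26] -/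
theorem dvCoef_le (hω : 0 < ω₂) (hl : 0 < lam) (hβ : 0 < β)
    {μ : (N : ℕ) → ℝ → ℝ → Measure (PhaseSpace N)} (hμ : IsSteadyFamily ω₂ lam β γ μ) (hT : 0 < T)
    {h : PhaseSpace N → ℝ}
    (hhL2 : MemLp h 2 ((pinnedChain ω₂ lam β γ).gibbsMeasure N T))
    (hresp : ∀ F : PhaseSpace N → ℝ, ContDiff ℝ ∞ F → HasCompactSupport F →
      Tendsto (fun δ : ℝ => ((∫ x, F x ∂(μ N (T + δ / 2) (T - δ / 2))) -
        ∫ x, F x ∂((pinnedChain ω₂ lam β γ).gibbsMeasure N T)) / δ) (𝓝[≠] 0)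
        (𝓝 (∫ x, F x * h x ∂((pinnedChain ω₂ lam β γ).gibbsMeasure N T))))
    {B : ℝ} (hB : 0 ≤ B)
    (hKL : ∀ᶠ δ in 𝓝[≠] (0 : ℝ), klDiv (μ N (T + δ / 2) (T - δ / 2))
      (Measure.map (fun x : PhaseSpace N => (x.1, -x.2)) (μ N (T + δ / 2) (T - δ / 2))) ≤ ENNReal.ofReal (B * δ ^ 2))
    {G : PhaseSpace N → ℝ} (hGs : ContDiff ℝ ∞ G) (hGc : HasCompactSupport G) :
    (∫ x, G x * (h x - h (x.1, -x.2)) ∂((pinnedChain ω₂ lam β γ).gibbsMeasure N T)) -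
      1 / 2 * ∫ x, G x ^ 2 ∂((pinnedChain ω₂ lam β γ).gibbsMeasure N T) ≤ B := by
  set P := pinnedChain ω₂ lam β γ with hP
  set μT := P.gibbsMeasure N T with hμT
  haveI hprob : IsProbabilityMeasure μT := pinnedChain_isProbabilityMeasure_gibbsMeasure hω hl.le hβ.le γ N hT
  have hGcont : Continuous G := hGs.continuous
  obtain ⟨M, hM⟩ := hGcont.bounded_above_of_compact_support hGc
  have hM' : ∀ x, |G x| ≤ M := fun x => by have e := hM x; rwa [Real.norm_eq_abs] at e
  have hinv : μT.map (fun x : PhaseSpace N => (x.1, -x.2)) = μT := gibbsMeasure_map_flip P N T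
  have hmp : MeasurePreserving (momentumReversal N) μT μT :=
    ⟨(momentumReversal N).measurable, gibbsMeasure_map_flip P N T⟩
  have hhΘL2 : MemLp (fun x => h (x.1, -x.2)) 2 μT := by
    have e : (fun x : PhaseSpace N => h (x.1, -x.2)) = h ∘ (momentumReversal N) := by funext x; simp
    exact e ▸ hhL2.comp_measurePreserving hmp
  have hhi : Integrable h μT := hhL2.integrable one_le_two
  have hhΘi : Integrable (fun x => h (x.1, -x.2)) μT := hhΘL2.integrable one_le_two
  -- the test functions `ψ = G∘Θ` and `ψ²`
  have hΘs : ContDiff ℝ ∞ (fun x : PhaseSpace N => ((x.1, -x.2) : PhaseSpace N)) := contDiff_fst.prodMk contDiff_snd.neg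
  have hψs : ContDiff ℝ ∞ (fun x : PhaseSpace N => G (x.1, -x.2)) := hGs.comp hΘs
  have hψc : HasCompactSupport (fun x : PhaseSpace N => G (x.1, -x.2)) :=
    hGc.comp_homeomorph ((Homeomorph.refl (Fin N → ℝ)).prodCongr (Homeomorph.neg (Fin N → ℝ)))
  have hψ2s : ContDiff ℝ ∞ (fun x : PhaseSpace N => G (x.1, -x.2) ^ 2) := hψs.pow 2
  have hψ2c : HasCompactSupport (fun x : PhaseSpace N => G (x.1, -x.2) ^ 2) :=
    hψc.comp_left (g := fun t : ℝ => t ^ 2) (by simp)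
  -- response limits
  have t1 := hresp G hGs hGc
  have t2 := hresp _ hψs hψc
  have t2v := tendsto_of_tendsto_sub_div t2
  have t4v := tendsto_of_tendsto_sub_div (hresp _ hψ2s hψ2c)
  -- flip identities under `μ_T`
  have hψT : ∫ x, G (x.1, -x.2) ∂μT = ∫ x, G x ∂μT := integral_comp_flip μT hinv G
  have hψ2T : ∫ x, G (x.1, -x.2) ^ 2 ∂μT = ∫ x, G x ^ 2 ∂μT := integral_comp_flip μT hinv (fun y => G y ^ 2)
  have hcv : ∫ x, G (x.1, -x.2) * h x ∂μT = ∫ x, G x * h (x.1, -x.2) ∂μT := by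
    have e := hmp.integral_comp' (fun y => G y * h (y.1, -y.2))
    simp only [momentumReversal_apply, neg_neg, Prod.mk.eta] at e
    exact e
  have hi1 : Integrable (fun x => G x * h x) μT := hhi.bdd_mul hGcont.aestronglyMeasurable (ae_of_all _ hM)
  have hi2 : Integrable (fun x => G x * h (x.1, -x.2)) μT :=
    hhΘi.bdd_mul hGcont.aestronglyMeasurable (ae_of_all _ hM)
  -- small parameter: `|δ|(M + |m|) ≤ 1` eventually, and `|δ|(M+|m|)³ → 0`
  have hδ0 : Tendsto (fun δ : ℝ => δ) (𝓝[≠] 0) (𝓝 0) := tendsto_id.mono_left nhdsWithin_le_nhds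
  have hsmall : ∀ᶠ δ in 𝓝[≠] (0 : ℝ), |δ| * (M + |∫ x, G x ∂μT|) ≤ 1 := by
    have h0 : Tendsto (fun δ : ℝ => |δ| * (M + |∫ x, G x ∂μT|)) (𝓝[≠] 0) (𝓝 (|0| * (M + |∫ x, G x ∂μT|))) :=
      hδ0.abs.mul_const _
    rw [abs_zero, zero_mul] at h0
    exact h0.eventually (eventually_le_nhds one_pos)
  have habs : Tendsto (fun δ : ℝ => |δ| * (M + |∫ x, G x ∂μT|) ^ 3) (𝓝[≠] 0) (𝓝 0) := by
    have h0 := hδ0.abs.mul_const ((M + |∫ x, G x ∂μT|) ^ 3)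
    rwa [abs_zero, zero_mul] at h0
  -- the limit of the lower bound `W(δ)`
  have tS := (t4v.sub (t2v.const_mul (2 * ∫ x, G x ∂μT))).add
    (tendsto_const_nhds (x := (∫ x, G x ∂μT) ^ 2) (f := 𝓝[≠] (0 : ℝ)))
  have tW := (((t1.sub t2).sub (tS.div_const 2)).sub habs)
  -- `W(δ) ≤ B` eventually
  have hWev : ∀ᶠ δ in 𝓝[≠] (0 : ℝ),
      ((∫ x, G x ∂(μ N (T + δ / 2) (T - δ / 2))) - ∫ x, G x ∂μT) / δ -
        ((∫ x, G (x.1, -x.2) ∂(μ N (T + δ / 2) (T - δ / 2))) - ∫ x, G (x.1, -x.2) ∂μT) / δ -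
        ((∫ x, G (x.1, -x.2) ^ 2 ∂(μ N (T + δ / 2) (T - δ / 2))) -
          2 * (∫ x, G x ∂μT) * (∫ x, G (x.1, -x.2) ∂(μ N (T + δ / 2) (T - δ / 2))) + (∫ x, G x ∂μT) ^ 2) / 2 -
        |δ| * (M + |∫ x, G x ∂μT|) ^ 3 ≤ B := by
    filter_upwards [hKL, self_mem_nhdsWithin, eventually_bath_temps_pos hT, hsmall] with δ hδ hne hδT hsm
    have hne' : δ ≠ 0 := hne
    haveI hν : IsProbabilityMeasure (μ N (T + δ / 2) (T - δ / 2)) := (hμ N _ _ hδT.1 hδT.2).1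
    -- abbreviations (as plain facts)
    have hδ2 : 0 < δ ^ 2 := lt_of_le_of_ne (sq_nonneg δ) (Ne.symm (pow_ne_zero 2 hne'))
    have iG : Integrable G (μ N (T + δ / 2) (T - δ / 2)) := hGcont.integrable_of_hasCompactSupport hGc
    have iψ : Integrable (fun x : PhaseSpace N => G (x.1, -x.2)) (μ N (T + δ / 2) (T - δ / 2)) :=
      hψs.continuous.integrable_of_hasCompactSupport hψc
    have iψ2 : Integrable (fun x : PhaseSpace N => G (x.1, -x.2) ^ 2) (μ N (T + δ / 2) (T - δ / 2)) :=
      hψ2s.continuous.integrable_of_hasCompactSupport hψ2c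
    have hub : ∀ x : PhaseSpace N, |δ * (G (x.1, -x.2) - ∫ y, G y ∂μT)| ≤ |δ| * (M + |∫ y, G y ∂μT|) :=
      fun x => by
        rw [abs_mul]
        exact mul_le_mul_of_nonneg_left ((abs_sub _ _).trans (add_le_add (hM' _) le_rfl)) (abs_nonneg δ)
    have hu1 : ∀ x : PhaseSpace N, |δ * (G (x.1, -x.2) - ∫ y, G y ∂μT)| ≤ 1 := fun x => (hub x).trans hsm
    have cu : Continuous (fun x : PhaseSpace N => δ * (G (x.1, -x.2) - ∫ y, G y ∂μT)) := by
      have := hψs.continuous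
      fun_prop
    have iu : Integrable (fun x : PhaseSpace N => δ * (G (x.1, -x.2) - ∫ y, G y ∂μT)) (μ N (T + δ / 2) (T - δ / 2)) :=
      (iψ.sub (integrable_const _)).const_mul δ
    have cE : Continuous (fun x : PhaseSpace N => Real.exp (δ * (G (x.1, -x.2) - ∫ y, G y ∂μT))) :=
      Real.continuous_exp.comp cu
    have hEb : ∀ x : PhaseSpace N, ‖Real.exp (δ * (G (x.1, -x.2) - ∫ y, G y ∂μT))‖ ≤ Real.exp 1 := fun x => by
      rw [Real.norm_eq_abs, abs_of_pos (Real.exp_pos _)]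
      exact Real.exp_le_exp.2 ((le_abs_self _).trans (hu1 x))
    have iE : Integrable (fun x : PhaseSpace N => Real.exp (δ * (G (x.1, -x.2) - ∫ y, G y ∂μT)) - 1)
        (μ N (T + δ / 2) (T - δ / 2)) :=
      ((integrable_const (Real.exp 1)).mono' cE.aestronglyMeasurable (ae_of_all _ hEb)).sub (integrable_const 1)
    have iu2 : Integrable (fun x : PhaseSpace N => (δ * (G (x.1, -x.2) - ∫ y, G y ∂μT)) ^ 2 / 2)
        (μ N (T + δ / 2) (T - δ / 2)) := by
      have e : (fun x : PhaseSpace N => (δ * (G (x.1, -x.2) - ∫ y, G y ∂μT)) ^ 2 / 2) =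
          fun x => δ ^ 2 / 2 * (G (x.1, -x.2) ^ 2 - 2 * (∫ y, G y ∂μT) * G (x.1, -x.2) + (∫ y, G y ∂μT) ^ 2) := by
        funext x; ring
      rw [e]
      exact ((iψ2.sub' (iψ.const_mul _)).add (integrable_const _)).const_mul _
    -- (1) Donsker–Varadhan (easy half) with `g = δ(G − μ_T(G))`
    have hfin : klDiv (μ N (T + δ / 2) (T - δ / 2))
        (Measure.map (fun x : PhaseSpace N => (x.1, -x.2)) (μ N (T + δ / 2) (T - δ / 2))) ≠ ⊤ :=
      ne_top_of_le_ne_top ENNReal.ofReal_ne_top hδ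
    have hgi : Integrable (fun x : PhaseSpace N => δ * (G x - ∫ y, G y ∂μT)) (μ N (T + δ / 2) (T - δ / 2)) :=
      (iG.sub (integrable_const _)).const_mul δ
    have hgb : ∀ x : PhaseSpace N, |δ * (G x - ∫ y, G y ∂μT)| ≤ 1 := fun x => by
      refine le_trans ?_ hsm
      rw [abs_mul]
      exact mul_le_mul_of_nonneg_left ((abs_sub _ _).trans (add_le_add (hM' _) le_rfl)) (abs_nonneg δ)
    have cg : Continuous (fun x : PhaseSpace N => Real.exp (δ * (G x - ∫ y, G y ∂μT))) := by fun_prop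
    have hexpi : Integrable (fun x : PhaseSpace N => Real.exp (δ * (G x - ∫ y, G y ∂μT)))
        (Measure.map (fun x : PhaseSpace N => (x.1, -x.2)) (μ N (T + δ / 2) (T - δ / 2))) :=
      (integrable_const (Real.exp 1)).mono' cg.aestronglyMeasurable (ae_of_all _ fun x => by
        rw [Real.norm_eq_abs, abs_of_pos (Real.exp_pos _)]
        exact Real.exp_le_exp.2 ((le_abs_self _).trans (hgb x)))
    have hDV := Literature.Probability.Divergences.integral_le_toReal_klDiv_add_integral hfin hgi hexpi
    have hKLr : (klDiv (μ N (T + δ / 2) (T - δ / 2))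
        (Measure.map (fun x : PhaseSpace N => (x.1, -x.2)) (μ N (T + δ / 2) (T - δ / 2)))).toReal ≤ B * δ ^ 2 :=
      ENNReal.toReal_le_of_le_ofReal (by positivity) hδ
    have hmap : ∫ x, (Real.exp (δ * (G x - ∫ y, G y ∂μT)) - 1)
        ∂(Measure.map (fun x : PhaseSpace N => (x.1, -x.2)) (μ N (T + δ / 2) (T - δ / 2))) =
        ∫ x, (Real.exp (δ * (G (x.1, -x.2) - ∫ y, G y ∂μT)) - 1) ∂(μ N (T + δ / 2) (T - δ / 2)) :=
      integral_map (measurable_fst.prodMk measurable_snd.neg).aemeasurable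
        (cg.sub continuous_const).aestronglyMeasurable
    have hgint : ∫ x, δ * (G x - ∫ y, G y ∂μT) ∂(μ N (T + δ / 2) (T - δ / 2)) =
        δ * ((∫ x, G x ∂(μ N (T + δ / 2) (T - δ / 2))) - ∫ y, G y ∂μT) := by
      rw [integral_const_mul, integral_sub iG (integrable_const _), integral_const, probReal_univ, one_smul]
    rw [hgint, hmap] at hDV
    -- (2) Taylor: `∫ (e^u − 1) = δ(∫ψ − m) + (δ²/2)(∫ψ² − 2m∫ψ + m²) + R`, `|R| ≤ |δ|³(M+|m|)³`
    have hIu : ∫ x, δ * (G (x.1, -x.2) - ∫ y, G y ∂μT) ∂(μ N (T + δ / 2) (T - δ / 2)) =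
        δ * ((∫ x, G (x.1, -x.2) ∂(μ N (T + δ / 2) (T - δ / 2))) - ∫ y, G y ∂μT) := by
      rw [integral_const_mul, integral_sub iψ (integrable_const _), integral_const, probReal_univ, one_smul]
    have hIu2 : ∫ x, (δ * (G (x.1, -x.2) - ∫ y, G y ∂μT)) ^ 2 / 2 ∂(μ N (T + δ / 2) (T - δ / 2)) =
        δ ^ 2 / 2 * ((∫ x, G (x.1, -x.2) ^ 2 ∂(μ N (T + δ / 2) (T - δ / 2))) -
          2 * (∫ y, G y ∂μT) * (∫ x, G (x.1, -x.2) ∂(μ N (T + δ / 2) (T - δ / 2))) + (∫ y, G y ∂μT) ^ 2) := by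
      have e : (fun x : PhaseSpace N => (δ * (G (x.1, -x.2) - ∫ y, G y ∂μT)) ^ 2 / 2) =
          fun x => δ ^ 2 / 2 * (G (x.1, -x.2) ^ 2 - 2 * (∫ y, G y ∂μT) * G (x.1, -x.2) + (∫ y, G y ∂μT) ^ 2) := by
        funext x; ring
      rw [e, integral_const_mul, integral_add (iψ2.sub' (iψ.const_mul _)) (integrable_const _),
        integral_sub iψ2 (iψ.const_mul _), integral_const_mul, integral_const, probReal_univ, one_smul]
    have hR : |(∫ x, (Real.exp (δ * (G (x.1, -x.2) - ∫ y, G y ∂μT)) - 1) ∂(μ N (T + δ / 2) (T - δ / 2))) -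
        δ * ((∫ x, G (x.1, -x.2) ∂(μ N (T + δ / 2) (T - δ / 2))) - ∫ y, G y ∂μT) -
        δ ^ 2 / 2 * ((∫ x, G (x.1, -x.2) ^ 2 ∂(μ N (T + δ / 2) (T - δ / 2))) -
          2 * (∫ y, G y ∂μT) * (∫ x, G (x.1, -x.2) ∂(μ N (T + δ / 2) (T - δ / 2))) + (∫ y, G y ∂μT) ^ 2)| ≤
        |δ| ^ 3 * (M + |∫ y, G y ∂μT|) ^ 3 := by
      rw [← hIu, ← hIu2, ← integral_sub iE iu, ← integral_sub (iE.sub' iu) iu2]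
      have hb := norm_integral_le_of_norm_le_const (μ := μ N (T + δ / 2) (T - δ / 2))
        (f := fun x : PhaseSpace N => Real.exp (δ * (G (x.1, -x.2) - ∫ y, G y ∂μT)) - 1 -
          δ * (G (x.1, -x.2) - ∫ y, G y ∂μT) - (δ * (G (x.1, -x.2) - ∫ y, G y ∂μT)) ^ 2 / 2)
        (C := (|δ| * (M + |∫ y, G y ∂μT|)) ^ 3) (ae_of_all _ fun x => by
          rw [Real.norm_eq_abs]
          exact (abs_exp_sub_taylor_two_le (hu1 x)).trans (pow_le_pow_left₀ (abs_nonneg _) (hub x) 3))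
      rw [probReal_univ, mul_one, Real.norm_eq_abs, mul_pow] at hb
      exact hb
    -- (3) assemble: `W(δ)·δ² ≤ B·δ²`
    have h3 : |δ| ^ 3 = |δ| * δ ^ 2 := by
      rw [← sq_abs]; ring
    rw [h3] at hR
    have hR' := (abs_le.1 hR).2
    rw [hψT]
    rw [← sub_nonneg]
    have key : 0 ≤ (B - (((∫ x, G x ∂(μ N (T + δ / 2) (T - δ / 2))) - ∫ x, G x ∂μT) / δ -
        ((∫ x, G (x.1, -x.2) ∂(μ N (T + δ / 2) (T - δ / 2))) - ∫ x, G x ∂μT) / δ -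
        ((∫ x, G (x.1, -x.2) ^ 2 ∂(μ N (T + δ / 2) (T - δ / 2))) -
          2 * (∫ x, G x ∂μT) * (∫ x, G (x.1, -x.2) ∂(μ N (T + δ / 2) (T - δ / 2))) + (∫ x, G x ∂μT) ^ 2) / 2 -
        |δ| * (M + |∫ x, G x ∂μT|) ^ 3)) * δ ^ 2 := by
      have e : (B - (((∫ x, G x ∂(μ N (T + δ / 2) (T - δ / 2))) - ∫ x, G x ∂μT) / δ -
          ((∫ x, G (x.1, -x.2) ∂(μ N (T + δ / 2) (T - δ / 2))) - ∫ x, G x ∂μT) / δ -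
          ((∫ x, G (x.1, -x.2) ^ 2 ∂(μ N (T + δ / 2) (T - δ / 2))) -
            2 * (∫ x, G x ∂μT) * (∫ x, G (x.1, -x.2) ∂(μ N (T + δ / 2) (T - δ / 2))) + (∫ x, G x ∂μT) ^ 2) / 2 -
          |δ| * (M + |∫ x, G x ∂μT|) ^ 3)) * δ ^ 2 =
          B * δ ^ 2 - δ * ((∫ x, G x ∂(μ N (T + δ / 2) (T - δ / 2))) - ∫ x, G x ∂μT) +
            δ * ((∫ x, G (x.1, -x.2) ∂(μ N (T + δ / 2) (T - δ / 2))) - ∫ x, G x ∂μT) +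
            δ ^ 2 / 2 * ((∫ x, G (x.1, -x.2) ^ 2 ∂(μ N (T + δ / 2) (T - δ / 2))) -
              2 * (∫ x, G x ∂μT) * (∫ x, G (x.1, -x.2) ∂(μ N (T + δ / 2) (T - δ / 2))) + (∫ x, G x ∂μT) ^ 2) +
            |δ| * δ ^ 2 * (M + |∫ x, G x ∂μT|) ^ 3 := by
        field_simp
        ring
      rw [e]
      nlinarith [hDV, hKLr, hR']
    exact nonneg_of_mul_nonneg_left key hδ2
  -- the limit
  have hL := le_of_tendsto tW hWev
  rw [hψT, hψ2T, hcv, sub_zero] at hL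
  rw [integral_congr_ae (show (fun x => G x * (h x - h (x.1, -x.2))) =ᵐ[μT] fun x => G x * h x - G x * h (x.1, -x.2)
    from ae_of_all _ fun x => by ring), integral_sub hi1 hi2]
  nlinarith [hL, sq_nonneg (∫ x, G x ∂μT)]

/-- **(L₂) `SnapshotKLLowerExpansion` — PROVED.** Fixed `N`: if `KL(μ_δ ‖ Θ_*μ_δ) ≤ Bδ²` eventually (`B ≥ 0`), then
`½∫ (h − h∘Θ)² dμ_{N,T,T} ≤ B` for every response density `h` — `dvCoef_le` at a test function `G` with
`∫ (G − (h − h∘Θ))² dμ_T` small (density of `C_c^∞` in `L²(μ_T)`, tree `exists_smooth_integral_sub_sq_le`) and the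
polarisation `∫ G k − ½∫ G² = ½∫ k² − ½∫ (G − k)²`. [cite: PolyanskiyWu2024, Thm. 7.26] -/
theorem snapshotKLLowerExpansion_holds : SnapshotKLLowerExpansion := by
  intro ω₂ lam β γ hω hl hβ hγ hU μ hμ T hT N h hh B hB hKL
  set P := pinnedChain ω₂ lam β γ with hP
  set μT := P.gibbsMeasure N T with hμT
  haveI hprob : IsProbabilityMeasure μT := pinnedChain_isProbabilityMeasure_gibbsMeasure hω hl.le hβ.le γ N hT
  have hG : μ N T T = μT :=
    hU N T T hT hT _ _ (hμ N T T hT hT) (pinnedChain_isSteadyState_gibbsMeasure hω hl.le hβ.le γ N hT)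
  obtain ⟨hhL2, hresp, -⟩ := hh
  rw [hG] at hhL2 hresp
  rw [hG]
  have hmp : MeasurePreserving (momentumReversal N) μT μT :=
    ⟨(momentumReversal N).measurable, gibbsMeasure_map_flip P N T⟩
  have hhΘL2 : MemLp (fun x => h (x.1, -x.2)) 2 μT := by
    have e : (fun x : PhaseSpace N => h (x.1, -x.2)) = h ∘ (momentumReversal N) := by funext x; simp
    exact e ▸ hhL2.comp_measurePreserving hmp
  have hkL2 : MemLp (fun x => h x - h (x.1, -x.2)) 2 μT := hhL2.sub hhΘL2
  by_contra hlt
  rw [not_le] at hlt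
  unfold oddDefect at hlt
  -- a test function close to `k = h − h∘Θ` in `L²(μ_T)`
  obtain ⟨G, hGs, hGc, hGcont, hGd⟩ := exists_smooth_integral_sub_sq_le μT hkL2
    (ε := ((∫ x, (h x - h (x.1, -x.2)) ^ 2 ∂μT) - 2 * B) / 2) (by linarith)
  obtain ⟨M, hM⟩ := hGcont.bounded_above_of_compact_support hGc
  have hGL2 : MemLp G 2 μT := hGcont.memLp_of_hasCompactSupport hGc
  have iGk : Integrable (fun x => G x * (h x - h (x.1, -x.2))) μT :=
    (hkL2.integrable one_le_two).bdd_mul hGcont.aestronglyMeasurable (ae_of_all _ hM)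
  have iG2 : Integrable (fun x => G x ^ 2) μT := hGL2.integrable_sq
  have ik2 : Integrable (fun x => (h x - h (x.1, -x.2)) ^ 2) μT := hkL2.integrable_sq
  have hpol : ∫ x, (G x - (h x - h (x.1, -x.2))) ^ 2 ∂μT =
      (∫ x, G x ^ 2 ∂μT) - 2 * (∫ x, G x * (h x - h (x.1, -x.2)) ∂μT) + ∫ x, (h x - h (x.1, -x.2)) ^ 2 ∂μT := by
    have e : (fun x => (G x - (h x - h (x.1, -x.2))) ^ 2) =
        fun x => G x ^ 2 - 2 * (G x * (h x - h (x.1, -x.2))) + (h x - h (x.1, -x.2)) ^ 2 := by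
      funext x; ring
    rw [e, integral_add (iG2.sub' (iGk.const_mul 2)) ik2, integral_sub iG2 (iGk.const_mul 2), integral_const_mul]
  have h1 := dvCoef_le (N := N) hω hl hβ hμ hT hhL2 hresp hB hKL hGs hGc
  linarith [hGd, hpol, h1]

end KL

/-! ## §3 The seams one hypothesis lighter -/

/-- **`(K) ⟹ (O₁)`**: extensive snapshot irreversibility (stmt-9121) gives the linear odd-defect grade,
unconditionally ((L₂) discharged). [folklore] -/
theorem oddSnapshotGrade_one_of_extensiveSnapshot : ExtensiveSnapshotIrreversibility → OddSnapshotGrade 1 :=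
  oddSnapshotGrade_one_of_snapshot snapshotKLLowerExpansion_holds

/-- **`(L) ∧ (K) ⟹ TransientFloor 1`** ((L₂) discharged). [folklore] -/
theorem transientFloor_one_of_parityFloor_extensiveSnapshot :
    OvershootParityFloor → ExtensiveSnapshotIrreversibility → TransientFloor 1 :=
  fun hL => transientFloor_one_of_snapshot hL snapshotKLLowerExpansion_holds

/-- **`(D) ∧ (L) ∧ (K) ⟹ BoundedResponse` (stmt-AtomisticToContinuum-11071) BY NAME** ((L₂) discharged; (L) is the theorem
`overshootParityFloor_holds` of the sibling file `…ParityFloorProof.lean`, whence `11071 ⟸ (D) ∧ (K)`). [folklore] -/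
theorem boundedResponse_of_deficitCesaroPoint_parityFloor :
    DeficitCesaroPoint → OvershootParityFloor → ExtensiveSnapshotIrreversibility → BoundedResponse :=
  fun hD hL => boundedResponse_of_deficitCesaroPoint_snapshot hD hL snapshotKLLowerExpansion_holds

/-- The same seam in the escape-exponent language: `(D) ∧ (L) ∧ (K) ⟹ OhmicFloor`. [folklore] -/
theorem ohmicFloor_of_deficitCesaroPoint_parityFloor :
    DeficitCesaroPoint → OvershootParityFloor → ExtensiveSnapshotIrreversibility → OhmicFloor :=
  fun hD hL => ohmicFloor_of_deficitCesaroPoint_snapshot hD hL snapshotKLLowerExpansion_holds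

end Summit.AtomisticToContinuum.FouriersLaw.Theorems.BoundedResponse.ParityFloor

end
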